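import Summits.MatrixMultiplication.MatrixMultiplication.Theses.DefinableSTPPDichotomy

/-!
# `HexagonClearanceR` (stmt-MatrixMultiplication-17884), line Sketch:
# stub `stub_massBound_of_shadowBound` (shadow bound ⇒ uniform mass bound)

Elementary counting step of the vacuity proof of `HexagonClearanceR`, ported WITHOUT auxiliary
definitions from `Cruxes/PairwiseCurvedTilingsLC/LonelyTranslates.lean` (§1–§2 and the orientation
trick of §3): for a family `(A_x, B_x, C_x)_{x ∈ I}` in a finite abelian group `H = F^m` satisfying
the PAIRWISE STPP clause — the `A − C` packing `Σ_k |A_k||C_k| = |⋃_k (A_k − C_k)| ≤ |H|`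
(`MassBound.card_acShadow`, `MassBound.sum_card_mul_card_le`), block TPP
(`MassBound.card_mul_card_mul_card_le`), rotation invariance of the clause
(`MassBound.pairwiseClause_rotate`), the three-term AM–GM `MassBound.rpow_block_le`, the mass
bound `MassBound.mass_le_of_shadowBound`
(`Σ_I (|A||B||C|)^{(2+ε)/3} ≤ (C + (2+C)/3) q^m` if the blocks with `|B_x| > C` have
`Σ |A_x||C_x| ≤ C q^{m−1}`), and the registered stub (hypothesis oriented on the big-`A` blocks, so
the mass lemma is applied to the rotated family `(C, A, B)`; `K := C₀ + (2 + C₀)/3`, same `q₁`).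
-/

set_option linter.dupNamespace false

namespace Summit.MatrixMultiplication.MatrixMultiplication.Theorems.HexagonClearanceR.MassBound

open Finset

section Combinatorial

variable {H : Type*} [AddCommGroup H] {ι : Type*}

/-- The pairwise clause implies the `i = j` pattern (block TPP for `k = i`, porosity of the
`A − C` packing along `B − B` for `k ≠ i`). -/
theorem patternIJ_of_pairwise {I : Finset ι} {A B C : ι → Finset H}
    (h : ∀ i ∈ I, ∀ j ∈ I, ∀ k ∈ I, (i = j ∨ j = k ∨ k = i) →
      ∀ s ∈ A k, ∀ s' ∈ A i, ∀ t ∈ B i, ∀ t' ∈ B j, ∀ u ∈ C j, ∀ u' ∈ C k,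
        (s' - s) + (t' - t) + (u' - u) = 0 → i = j ∧ j = k ∧ s = s' ∧ t = t' ∧ u = u') :
    ∀ i ∈ I, ∀ k ∈ I, ∀ s ∈ A k, ∀ s' ∈ A i, ∀ t ∈ B i, ∀ t' ∈ B i, ∀ u ∈ C i, ∀ u' ∈ C k,
      (s' - s) + (t' - t) + (u' - u) = 0 → i = k ∧ s = s' ∧ t = t' ∧ u = u' := by
  intro i hi k hk s hs s' hs' t ht t' ht' u hu u' hu' h0
  obtain ⟨-, hik, hss, htt, huu⟩ :=
    h i hi i hi k hk (Or.inl rfl) s hs s' hs' t ht t' ht' u hu u' hu' h0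
  exact ⟨hik, hss, htt, huu⟩

/-- Packing of the `A − C` shadow: under the `i = j` pattern (and all `B_k ≠ ∅`) the shadow
`⋃_{k ∈ I} (A_k − C_k)` is a disjoint union and each block `A_k × C_k` embeds, so its cardinality
is `Σ_k |A_k||C_k|`. -/
theorem card_acShadow [DecidableEq H] {I : Finset ι} {A B C : ι → Finset H}
    (h : ∀ i ∈ I, ∀ k ∈ I, ∀ s ∈ A k, ∀ s' ∈ A i, ∀ t ∈ B i, ∀ t' ∈ B i, ∀ u ∈ C i, ∀ u' ∈ C k,
      (s' - s) + (t' - t) + (u' - u) = 0 → i = k ∧ s = s' ∧ t = t' ∧ u = u')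
    (hB : ∀ k ∈ I, (B k).Nonempty) :
    (I.biUnion fun k => Finset.image₂ (· - ·) (A k) (C k)).card =
      ∑ k ∈ I, (A k).card * (C k).card := by
  classical
  rw [card_biUnion]
  · refine sum_congr rfl fun k hk => ?_
    rw [card_image₂_iff.2]
    intro ⟨a, c⟩ hac ⟨a', c'⟩ hac' heq
    simp only [Set.mem_prod, mem_coe] at hac hac'
    obtain ⟨t, ht⟩ := hB k hk
    have h0 : (a' - a) + (t - t) + (c - c') = 0 := by
      have : (a' - a) + (t - t) + (c - c') = (a' - c') - (a - c) := by abel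
      rw [this]; exact sub_eq_zero.2 heq.symm
    obtain ⟨-, haa, -, hcc⟩ := h k hk k hk a hac.1 a' hac'.1 t ht t ht c' hac'.2 c hac.2 h0
    exact Prod.ext haa hcc.symm
  · intro k hk l hl hkl
    rw [Function.onFun, disjoint_left]
    intro v hvk hvl
    simp only [mem_image₂] at hvk hvl
    obtain ⟨a, ha, c, hc, rfl⟩ := hvk
    obtain ⟨a', ha', c', hc', he⟩ := hvl
    obtain ⟨t, ht⟩ := hB k hk
    have h0 : (a - a') + (t - t) + (c' - c) = 0 := by
      have : (a - a') + (t - t) + (c' - c) = (a - c) - (a' - c') := by abel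
      rw [this, he, sub_self]
    exact hkl (h k hk l hl a' ha' a ha t ht t ht c hc c' hc' h0).1

/-- `A − C` packing: `Σ_k |A_k||C_k| ≤ |H|` under the `i = j` pattern (all `B_k ≠ ∅`). -/
theorem sum_card_mul_card_le [Fintype H] {I : Finset ι} {A B C : ι → Finset H}
    (h : ∀ i ∈ I, ∀ k ∈ I, ∀ s ∈ A k, ∀ s' ∈ A i, ∀ t ∈ B i, ∀ t' ∈ B i, ∀ u ∈ C i, ∀ u' ∈ C k,
      (s' - s) + (t' - t) + (u' - u) = 0 → i = k ∧ s = s' ∧ t = t' ∧ u = u')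
    (hB : ∀ k ∈ I, (B k).Nonempty) :
    ∑ k ∈ I, (A k).card * (C k).card ≤ Fintype.card H := by
  classical
  rw [← card_acShadow h hB]; exact card_le_univ _

/-- Block TPP: `|A_i||B_i||C_i| ≤ |H|` under the `i = j` pattern (the sum map is injective on
`A_i × B_i × C_i`). -/
theorem card_mul_card_mul_card_le [Fintype H] {I : Finset ι} {A B C : ι → Finset H}
    (h : ∀ i ∈ I, ∀ k ∈ I, ∀ s ∈ A k, ∀ s' ∈ A i, ∀ t ∈ B i, ∀ t' ∈ B i, ∀ u ∈ C i, ∀ u' ∈ C k,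
      (s' - s) + (t' - t) + (u' - u) = 0 → i = k ∧ s = s' ∧ t = t' ∧ u = u')
    {i : ι} (hi : i ∈ I) :
    (A i).card * (B i).card * (C i).card ≤ Fintype.card H := by
  classical
  have hinj : Set.InjOn (fun p : H × H × H => p.1 + (p.2.1 + p.2.2))
      ((A i) ×ˢ ((B i) ×ˢ (C i)) : Finset (H × H × H)) := by
    rintro ⟨a₁, b₁, c₁⟩ h₁ ⟨a₂, b₂, c₂⟩ h₂ heq
    simp only [coe_product, Set.mem_prod, mem_coe] at h₁ h₂
    have h0 : (a₁ - a₂) + (b₁ - b₂) + (c₁ - c₂) = 0 := by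
      have : (a₁ - a₂) + (b₁ - b₂) + (c₁ - c₂) = (a₁ + (b₁ + c₁)) - (a₂ + (b₂ + c₂)) := by abel
      rw [this]; exact sub_eq_zero.2 heq
    obtain ⟨-, ha, hb, hc⟩ :=
      h i hi i hi a₂ h₂.1 a₁ h₁.1 b₂ h₂.2.1 b₁ h₁.2.1 c₂ h₂.2.2 c₁ h₁.2.2 h0
    rw [ha, hb, hc]
  have := card_le_card_of_injOn _ (fun p _ => mem_univ _) hinj
  simpa [card_product, card_univ, mul_assoc] using this

/-- The pairwise clause is invariant under the rotation `(A, B, C) ↦ (B, C, A)`. -/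
theorem pairwiseClause_rotate {I : Finset ι} {A B C : ι → Finset H}
    (h : ∀ i ∈ I, ∀ j ∈ I, ∀ k ∈ I, (i = j ∨ j = k ∨ k = i) →
      ∀ s ∈ A k, ∀ s' ∈ A i, ∀ t ∈ B i, ∀ t' ∈ B j, ∀ u ∈ C j, ∀ u' ∈ C k,
        (s' - s) + (t' - t) + (u' - u) = 0 → i = j ∧ j = k ∧ s = s' ∧ t = t' ∧ u = u') :
    ∀ i ∈ I, ∀ j ∈ I, ∀ k ∈ I, (i = j ∨ j = k ∨ k = i) →
      ∀ s ∈ B k, ∀ s' ∈ B i, ∀ t ∈ C i, ∀ t' ∈ C j, ∀ u ∈ A j, ∀ u' ∈ A k,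
        (s' - s) + (t' - t) + (u' - u) = 0 → i = j ∧ j = k ∧ s = s' ∧ t = t' ∧ u = u' := by
  intro i hi j hj k hk hijk s hs s' hs' t ht t' ht' u hu u' hu' h0
  -- original clause with `(i₀, j₀, k₀) := (k, i, j)`
  have h0' : (u' - u) + (s' - s) + (t' - t) = 0 := by rw [← h0]; abel
  have hor : (k = i ∨ i = j ∨ j = k) := by tauto
  obtain ⟨hki, hij, huu, hss, htt⟩ :=
    h k hk i hi j hj hor u hu u' hu' s hs s' hs' t ht t' ht' h0'
  exact ⟨hij, hij.symm.trans hki.symm, hss, htt, huu⟩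

end Combinatorial

section MassBound

variable {H : Type*} [AddCommGroup H] [Fintype H] {ι : Type*}

/-- The per-block inequality behind the big-`B` part: three-term AM–GM with weights `1/3` on
`(λab, λbc, μca)`, `λ = q^{-1/3}`, `μ = q^{2/3}`, and `(abc)^{ε/3} ≤ q^{mε/3} ≤ q^{1/3}`. -/
theorem rpow_block_le {q : ℝ} (hq : 1 ≤ q) {m : ℕ} {a b c : ℝ} (ha : 0 ≤ a) (hb : 0 ≤ b)
    (hc : 0 ≤ c) (h1 : 1 ≤ a * b * c) (hqm : a * b * c ≤ q ^ (m : ℝ)) {ε : ℝ} (hε : 0 < ε)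
    (hmε : (m : ℝ) * ε ≤ 1) :
    (a * b * c) ^ ((2 + ε) / 3) ≤ q ^ ((1 : ℝ) / 3) *
      ((q ^ (-(1 : ℝ) / 3) * (a * b) + q ^ (-(1 : ℝ) / 3) * (b * c) +
        q ^ ((2 : ℝ) / 3) * (c * a)) / 3) := by
  have hq0 : 0 < q := by linarith
  have hN : 0 < a * b * c := by linarith
  have hl0 : 0 < q ^ (-(1 : ℝ) / 3) := Real.rpow_pos_of_pos hq0 _
  have hm0 : 0 < q ^ ((2 : ℝ) / 3) := Real.rpow_pos_of_pos hq0 _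
  have hlm : q ^ (-(1 : ℝ) / 3) * q ^ (-(1 : ℝ) / 3) * q ^ ((2 : ℝ) / 3) = 1 := by
    rw [← Real.rpow_add hq0, ← Real.rpow_add hq0]; norm_num
  -- split the exponent
  have hsplit : (a * b * c) ^ ((2 + ε) / 3) =
      (a * b * c) ^ ((2 : ℝ) / 3) * (a * b * c) ^ (ε / 3) := by
    rw [← Real.rpow_add hN]; congr 1; ring
  -- the `ε/3` part
  have h2 : (a * b * c) ^ (ε / 3) ≤ q ^ ((1 : ℝ) / 3) := by
    calc (a * b * c) ^ (ε / 3) ≤ (q ^ (m : ℝ)) ^ (ε / 3) :=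
          Real.rpow_le_rpow hN.le hqm (by linarith)
      _ = q ^ ((m : ℝ) * (ε / 3)) := by rw [← Real.rpow_mul hq0.le]
      _ ≤ q ^ ((1 : ℝ) / 3) := Real.rpow_le_rpow_of_exponent_le hq (by nlinarith)
  -- AM–GM
  have hg := Real.geom_mean_le_arith_mean3_weighted (w₁ := 1 / 3) (w₂ := 1 / 3) (w₃ := 1 / 3)
    (p₁ := q ^ (-(1 : ℝ) / 3) * (a * b)) (p₂ := q ^ (-(1 : ℝ) / 3) * (b * c))
    (p₃ := q ^ ((2 : ℝ) / 3) * (c * a)) (by norm_num) (by norm_num) (by norm_num)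
    (by positivity) (by positivity) (by positivity) (by norm_num)
  have hprod : (q ^ (-(1 : ℝ) / 3) * (a * b)) ^ ((1 : ℝ) / 3) *
      (q ^ (-(1 : ℝ) / 3) * (b * c)) ^ ((1 : ℝ) / 3) *
      (q ^ ((2 : ℝ) / 3) * (c * a)) ^ ((1 : ℝ) / 3) = (a * b * c) ^ ((2 : ℝ) / 3) := by
    rw [← Real.mul_rpow (by positivity) (by positivity),
      ← Real.mul_rpow (by positivity) (by positivity)]
    have e : q ^ (-(1 : ℝ) / 3) * (a * b) * (q ^ (-(1 : ℝ) / 3) * (b * c)) *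
        (q ^ ((2 : ℝ) / 3) * (c * a)) = (a * b * c) ^ (2 : ℕ) := by
      have : q ^ (-(1 : ℝ) / 3) * (a * b) * (q ^ (-(1 : ℝ) / 3) * (b * c)) *
          (q ^ ((2 : ℝ) / 3) * (c * a)) =
          (q ^ (-(1 : ℝ) / 3) * q ^ (-(1 : ℝ) / 3) * q ^ ((2 : ℝ) / 3)) *
            (a * b * c) ^ (2 : ℕ) := by
        ring
      rw [this, hlm, one_mul]
    rw [e, ← Real.rpow_natCast, ← Real.rpow_mul hN.le]
    norm_num
  have h1 : (a * b * c) ^ ((2 : ℝ) / 3) ≤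
      (q ^ (-(1 : ℝ) / 3) * (a * b) + q ^ (-(1 : ℝ) / 3) * (b * c) +
        q ^ ((2 : ℝ) / 3) * (c * a)) / 3 := by
    rw [← hprod]; linarith
  rw [hsplit]
  calc (a * b * c) ^ ((2 : ℝ) / 3) * (a * b * c) ^ (ε / 3)
      ≤ ((q ^ (-(1 : ℝ) / 3) * (a * b) + q ^ (-(1 : ℝ) / 3) * (b * c) +
          q ^ ((2 : ℝ) / 3) * (c * a)) / 3) * q ^ ((1 : ℝ) / 3) :=
        mul_le_mul h1 h2 (by positivity) (by positivity)
    _ = _ := by ring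

/-- **Mass bound from a shadow bound.**  For a family satisfying the pairwise clause in a finite
abelian group of order `q^m` (`q ≥ 1`), if the blocks with `|B| > C` have `Σ |A||C| ≤ C q^{m−1}`,
then for every `0 < ε ≤ 1` with `mε ≤ 1` the mass at exponent `(2+ε)/3` is at most
`(C + (2+C)/3)·q^m` (small-`B` blocks: `(abc)^p ≤ abc ≤ C·ac` and the `A − C` packing; big-`B`
blocks: `rpow_block_le` and the three packings). -/
theorem mass_le_of_shadowBound (I : Finset ι) (A B C : ι → Finset H)
    (h : ∀ i ∈ I, ∀ j ∈ I, ∀ k ∈ I, (i = j ∨ j = k ∨ k = i) →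
      ∀ s ∈ A k, ∀ s' ∈ A i, ∀ t ∈ B i, ∀ t' ∈ B j, ∀ u ∈ C j, ∀ u' ∈ C k,
        (s' - s) + (t' - t) + (u' - u) = 0 → i = j ∧ j = k ∧ s = s' ∧ t = t' ∧ u = u')
    (Cb : ℕ) {q : ℝ} (hq : 1 ≤ q) (m : ℕ)
    (hH : (Fintype.card H : ℝ) = q ^ (m : ℝ))
    (hshadow : ∑ x ∈ I.filter (fun x => Cb < (B x).card), ((A x).card : ℝ) * (C x).card
      ≤ Cb * q ^ ((m : ℝ) - 1))
    {ε : ℝ} (hε : 0 < ε) (hε1 : ε ≤ 1) (hmε : (m : ℝ) * ε ≤ 1) :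
    ∑ x ∈ I, (((A x).card * (B x).card * (C x).card : ℕ) : ℝ) ^ ((2 + ε) / 3)
      ≤ ((Cb : ℝ) + (2 + Cb) / 3) * q ^ (m : ℝ) := by
  have hq0 : 0 < q := by linarith
  have hp0 : 0 < (2 + ε) / 3 := by linarith
  have hp1 : (2 + ε) / 3 ≤ 1 := by linarith
  -- blocks with all three sets non-empty (generalised to an opaque `I₀` for speed)
  obtain ⟨I₀, hI₀def⟩ : ∃ I₀ : Finset ι,
      I₀ = I.filter fun x => (A x).Nonempty ∧ (B x).Nonempty ∧ (C x).Nonempty := ⟨_, rfl⟩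
  have hI₀I : I₀ ⊆ I := by rw [hI₀def]; exact filter_subset _ _
  have hne : ∀ x ∈ I₀, (A x).Nonempty ∧ (B x).Nonempty ∧ (C x).Nonempty := by
    intro x hx
    rw [hI₀def, mem_filter] at hx
    exact hx.2
  have hsum0 : ∑ x ∈ I, (((A x).card * (B x).card * (C x).card : ℕ) : ℝ) ^ ((2 + ε) / 3) =
      ∑ x ∈ I₀, (((A x).card * (B x).card * (C x).card : ℕ) : ℝ) ^ ((2 + ε) / 3) := by
    rw [hI₀def, sum_filter_of_ne]
    intro x _ hx
    by_contra hcon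
    apply hx
    have h0 : (A x).card * (B x).card * (C x).card = 0 := by
      simp only [not_and_or, not_nonempty_iff_eq_empty] at hcon
      rcases hcon with h' | h' | h' <;> simp [h']
    rw [h0, Nat.cast_zero, Real.zero_rpow hp0.ne']
  -- the three patterns on `I₀`
  have h₀ := fun i hi j hj k hk => h i (hI₀I hi) j (hI₀I hj) k (hI₀I hk)
  have hIJ := patternIJ_of_pairwise h₀
  have hIJ' := patternIJ_of_pairwise (pairwiseClause_rotate h₀)
  have hIJ'' := patternIJ_of_pairwise (pairwiseClause_rotate (pairwiseClause_rotate h₀))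
  -- packings (as reals)
  have hAC : ∑ x ∈ I₀, ((A x).card : ℝ) * (C x).card ≤ q ^ (m : ℝ) := by
    have := sum_card_mul_card_le hIJ fun x hx => (hne x hx).2.1
    rw [← hH]; exact_mod_cast this
  have hBA : ∑ x ∈ I₀, ((B x).card : ℝ) * (A x).card ≤ q ^ (m : ℝ) := by
    have := sum_card_mul_card_le hIJ' fun x hx => (hne x hx).2.2
    rw [← hH]; exact_mod_cast this
  have hCB : ∑ x ∈ I₀, ((C x).card : ℝ) * (B x).card ≤ q ^ (m : ℝ) := by
    have := sum_card_mul_card_le hIJ'' fun x hx => (hne x hx).1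
    rw [← hH]; exact_mod_cast this
  have habc : ∀ x ∈ I₀, ((A x).card : ℝ) * (B x).card * (C x).card ≤ q ^ (m : ℝ) := by
    intro x hx
    rw [← hH]; exact_mod_cast card_mul_card_mul_card_le hIJ hx
  have habc1 : ∀ x ∈ I₀, (1 : ℝ) ≤ ((A x).card : ℝ) * (B x).card * (C x).card := by
    intro x hx
    obtain ⟨ha, hb, hc⟩ := hne x hx
    have : 1 ≤ (A x).card * (B x).card * (C x).card :=
      Nat.mul_pos (Nat.mul_pos ha.card_pos hb.card_pos) hc.card_pos
    exact_mod_cast this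
  have hcast : ∀ x, (((A x).card * (B x).card * (C x).card : ℕ) : ℝ) =
      ((A x).card : ℝ) * (B x).card * (C x).card := fun x => by push_cast; ring
  -- the clause is no longer needed: drop it (it slows down `positivity`'s hypothesis search)
  clear hIJ hIJ' hIJ'' h₀ h
  rw [hsum0, ← sum_filter_add_sum_filter_not I₀ (fun x => Cb < (B x).card)]
  simp_rw [hcast]
  -- (1) small-`B` blocks: `(abc)^p ≤ abc ≤ Cb·ac`
  have hT : ∑ x ∈ I₀.filter (fun x => ¬ Cb < (B x).card),
      (((A x).card : ℝ) * (B x).card * (C x).card) ^ ((2 + ε) / 3) ≤ Cb * q ^ (m : ℝ) := by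
    calc ∑ x ∈ I₀.filter (fun x => ¬ Cb < (B x).card),
          (((A x).card : ℝ) * (B x).card * (C x).card) ^ ((2 + ε) / 3)
        ≤ ∑ x ∈ I₀.filter (fun x => ¬ Cb < (B x).card),
            (Cb : ℝ) * (((A x).card : ℝ) * (C x).card) := by
          refine sum_le_sum fun x hx => ?_
          obtain ⟨hx₀, hxb⟩ := mem_filter.1 hx
          have hb : ((B x).card : ℝ) ≤ Cb := by exact_mod_cast not_lt.1 hxb
          calc (((A x).card : ℝ) * (B x).card * (C x).card) ^ ((2 + ε) / 3)
              ≤ ((A x).card : ℝ) * (B x).card * (C x).card :=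
                Real.rpow_le_self_of_one_le (habc1 x hx₀) hp1
            _ = ((B x).card : ℝ) * (((A x).card : ℝ) * (C x).card) := by ring
            _ ≤ (Cb : ℝ) * (((A x).card : ℝ) * (C x).card) :=
                mul_le_mul_of_nonneg_right hb (by positivity)
      _ ≤ ∑ x ∈ I₀, (Cb : ℝ) * (((A x).card : ℝ) * (C x).card) :=
          sum_le_sum_of_subset_of_nonneg (filter_subset _ _) fun x _ _ => by positivity
      _ = Cb * ∑ x ∈ I₀, ((A x).card : ℝ) * (C x).card := by rw [mul_sum]
      _ ≤ Cb * q ^ (m : ℝ) := mul_le_mul_of_nonneg_left hAC (Nat.cast_nonneg _)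
  -- (2) big-`B` blocks
  have hSI : I₀.filter (fun x => Cb < (B x).card) ⊆ I.filter fun x => Cb < (B x).card := by
    intro x hx
    obtain ⟨hx₀, hxb⟩ := mem_filter.1 hx
    exact mem_filter.2 ⟨hI₀I hx₀, hxb⟩
  have hSsh : ∑ x ∈ I₀.filter (fun x => Cb < (B x).card), ((C x).card : ℝ) * (A x).card
      ≤ Cb * q ^ ((m : ℝ) - 1) := by
    calc ∑ x ∈ I₀.filter (fun x => Cb < (B x).card), ((C x).card : ℝ) * (A x).card
        = ∑ x ∈ I₀.filter (fun x => Cb < (B x).card), ((A x).card : ℝ) * (C x).card :=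
          sum_congr rfl fun x _ => mul_comm _ _
      _ ≤ ∑ x ∈ I.filter (fun x => Cb < (B x).card), ((A x).card : ℝ) * (C x).card :=
          sum_le_sum_of_subset_of_nonneg hSI fun x _ _ => by positivity
      _ ≤ Cb * q ^ ((m : ℝ) - 1) := hshadow
  have hSab : ∑ x ∈ I₀.filter (fun x => Cb < (B x).card), ((A x).card : ℝ) * (B x).card
      ≤ q ^ (m : ℝ) := by
    calc ∑ x ∈ I₀.filter (fun x => Cb < (B x).card), ((A x).card : ℝ) * (B x).card
        ≤ ∑ x ∈ I₀, ((A x).card : ℝ) * (B x).card :=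
          sum_le_sum_of_subset_of_nonneg (filter_subset _ _) fun x _ _ => by positivity
      _ = ∑ x ∈ I₀, ((B x).card : ℝ) * (A x).card := sum_congr rfl fun x _ => mul_comm _ _
      _ ≤ q ^ (m : ℝ) := hBA
  have hSbc : ∑ x ∈ I₀.filter (fun x => Cb < (B x).card), ((B x).card : ℝ) * (C x).card
      ≤ q ^ (m : ℝ) := by
    calc ∑ x ∈ I₀.filter (fun x => Cb < (B x).card), ((B x).card : ℝ) * (C x).card
        ≤ ∑ x ∈ I₀, ((B x).card : ℝ) * (C x).card :=
          sum_le_sum_of_subset_of_nonneg (filter_subset _ _) fun x _ _ => by positivity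
      _ = ∑ x ∈ I₀, ((C x).card : ℝ) * (B x).card := sum_congr rfl fun x _ => mul_comm _ _
      _ ≤ q ^ (m : ℝ) := hCB
  have hS : ∑ x ∈ I₀.filter (fun x => Cb < (B x).card),
      (((A x).card : ℝ) * (B x).card * (C x).card) ^ ((2 + ε) / 3) ≤
        (2 + Cb) / 3 * q ^ (m : ℝ) := by
    calc ∑ x ∈ I₀.filter (fun x => Cb < (B x).card),
          (((A x).card : ℝ) * (B x).card * (C x).card) ^ ((2 + ε) / 3)
        ≤ ∑ x ∈ I₀.filter (fun x => Cb < (B x).card), q ^ ((1 : ℝ) / 3) *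
            ((q ^ (-(1 : ℝ) / 3) * (((A x).card : ℝ) * (B x).card) +
              q ^ (-(1 : ℝ) / 3) * (((B x).card : ℝ) * (C x).card) +
              q ^ ((2 : ℝ) / 3) * (((C x).card : ℝ) * (A x).card)) / 3) := by
          refine sum_le_sum fun x hx => ?_
          have hx₀ : x ∈ I₀ := (mem_filter.1 hx).1
          exact rpow_block_le hq (Nat.cast_nonneg _) (Nat.cast_nonneg _) (Nat.cast_nonneg _)
            (habc1 x hx₀) (habc x hx₀) hε hmε
      _ = q ^ ((1 : ℝ) / 3) / 3 *
            (q ^ (-(1 : ℝ) / 3) * ∑ x ∈ I₀.filter (fun x => Cb < (B x).card),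
                ((A x).card : ℝ) * (B x).card +
              q ^ (-(1 : ℝ) / 3) * ∑ x ∈ I₀.filter (fun x => Cb < (B x).card),
                ((B x).card : ℝ) * (C x).card +
              q ^ ((2 : ℝ) / 3) * ∑ x ∈ I₀.filter (fun x => Cb < (B x).card),
                ((C x).card : ℝ) * (A x).card) := by
          rw [mul_sum, mul_sum, mul_sum, ← sum_add_distrib, ← sum_add_distrib, mul_sum]
          exact sum_congr rfl fun x _ => by ring
      _ ≤ q ^ ((1 : ℝ) / 3) / 3 *
            (q ^ (-(1 : ℝ) / 3) * q ^ (m : ℝ) + q ^ (-(1 : ℝ) / 3) * q ^ (m : ℝ) +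
              q ^ ((2 : ℝ) / 3) * (Cb * q ^ ((m : ℝ) - 1))) := by
          have hl0 : 0 ≤ q ^ (-(1 : ℝ) / 3) := (Real.rpow_pos_of_pos hq0 _).le
          have hm0 : 0 ≤ q ^ ((2 : ℝ) / 3) := (Real.rpow_pos_of_pos hq0 _).le
          have hq3 : 0 ≤ q ^ ((1 : ℝ) / 3) / 3 := by positivity
          apply mul_le_mul_of_nonneg_left _ hq3
          exact add_le_add (add_le_add (mul_le_mul_of_nonneg_left hSab hl0)
            (mul_le_mul_of_nonneg_left hSbc hl0)) (mul_le_mul_of_nonneg_left hSsh hm0)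
      _ = (2 + Cb) / 3 * q ^ (m : ℝ) := by
          have e1 : q ^ ((1 : ℝ) / 3) * q ^ (-(1 : ℝ) / 3) * q ^ (m : ℝ) = q ^ (m : ℝ) := by
            rw [← Real.rpow_add hq0, ← Real.rpow_add hq0]; norm_num
          have e2 : q ^ ((1 : ℝ) / 3) * q ^ ((2 : ℝ) / 3) * q ^ ((m : ℝ) - 1) =
              q ^ (m : ℝ) := by
            rw [← Real.rpow_add hq0, ← Real.rpow_add hq0]; norm_num
          have : q ^ ((1 : ℝ) / 3) / 3 *
              (q ^ (-(1 : ℝ) / 3) * q ^ (m : ℝ) + q ^ (-(1 : ℝ) / 3) * q ^ (m : ℝ) +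
                q ^ ((2 : ℝ) / 3) * (Cb * q ^ ((m : ℝ) - 1))) =
              (2 * (q ^ ((1 : ℝ) / 3) * q ^ (-(1 : ℝ) / 3) * q ^ (m : ℝ)) +
                Cb * (q ^ ((1 : ℝ) / 3) * q ^ ((2 : ℝ) / 3) * q ^ ((m : ℝ) - 1))) / 3 := by
            ring
          rw [this, e1, e2]; ring
  calc ∑ x ∈ I₀.filter (fun x => Cb < (B x).card),
          (((A x).card : ℝ) * (B x).card * (C x).card) ^ ((2 + ε) / 3) +
        ∑ x ∈ I₀.filter (fun x => ¬ Cb < (B x).card),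
          (((A x).card : ℝ) * (B x).card * (C x).card) ^ ((2 + ε) / 3)
      ≤ (2 + Cb) / 3 * q ^ (m : ℝ) + Cb * q ^ (m : ℝ) := add_le_add hS hT
    _ = ((Cb : ℝ) + (2 + Cb) / 3) * q ^ (m : ℝ) := by ring

end MassBound

end Summit.MatrixMultiplication.MatrixMultiplication.Theorems.HexagonClearanceR.MassBound

namespace Summit.MatrixMultiplication.MatrixMultiplication.Theorems.HexagonClearanceR

open Finset

/-- **Stub `stub_massBound_of_shadowBound`** (line Sketch of `HexagonClearanceR`): the shadow
bound on the big-`A` blocks gives the uniform mass bound.  Given the formulas, take the shadow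
bound's `C₀, q₁` and `K := C₀ + (2 + C₀)/3`; for a realised family satisfying the pairwise
clause apply `MassBound.mass_le_of_shadowBound` to the rotated family `(C, A, B)` (whose big-`A`
shadow `Σ |C_x||B_x|` is the hypothesis' `Σ |B_x||C_x|`), with `|F^m| = |F|^m`, `|F| ≥ 1`, and
`ε ≤ 1`, `mε ≤ 1` from `ε ≤ 1/(m+1)`. -/
theorem stub_massBound_of_shadowBound (hS : (∀ (e m k : ℕ) (φI : FirstOrder.Language.ring.Formula (Fin e ⊕ Fin k)) (φA φB φC : FirstOrder.Language.ring.Formula ((Fin e ⊕ Fin m) ⊕ Fin k)), ∃ (C₀ q₁ : ℕ), ∀ (F : Type) [Field F] [Fintype F] [FirstOrder.Ring.CompatibleRing F], q₁ ≤ ringChar F → ∀ (y : Fin k → F) (I : Finset (Fin e → F)) (A B C : (Fin e → F) → Finset (Fin m → F)), (∀ x, x ∈ I ↔ φI.Realize (Sum.elim x y)) → (∀ x v, v ∈ A x ↔ φA.Realize (Sum.elim (Sum.elim x v) y)) → (∀ x v, v ∈ B x ↔ φB.Realize (Sum.elim (Sum.elim x v) y)) → (∀ x v, v ∈ C x ↔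 φC.Realize (Sum.elim (Sum.elim x v) y)) → (∀ i ∈ I, ∀ j ∈ I, ∀ k ∈ I, (i = j ∨ j = k ∨ k = i) → ∀ s ∈ A k, ∀ s' ∈ A i, ∀ t ∈ B i, ∀ t' ∈ B j, ∀ u ∈ C j, ∀ u' ∈ C k, (s' - s) + (t' - t) + (u' - u) = 0 → i = j ∧ j = k ∧ s = s' ∧ t = t' ∧ u = u') → ∑ x ∈ I.filter (fun x => C₀ < (A x).card), ((B x).card : ℝ) * (C x).card ≤ C₀ * (Fintype.card F : ℝ) ^ ((m : ℝ) - 1))) : (∀ (e m k : ℕ) (φI : FirstOrder.Language.ring.Formula (Fin e ⊕ Fin k)) (φA φB φC : FirstOrder.Language.ring.Formula ((Fin e ⊕ Fin m) ⊕ Fin k)), ∃ (K : ℝ) (q₁ : ℕ), ∀ (F : Type) [Field F] [Fintype F] [FirstOrder.Ring.CompatibleRing F], q₁ ≤ ringChar F → ∀ (y : Fin k → F) (I : Finset (Fin e → F)) (A B C : (Fin e → F) → Finset (Fin m → F)), (∀ x, x ∈ I ↔ φI.Realize (Sum.elim x y)) → (∀ x v, v ∈ A x ↔ φA.Realize (Sum.elim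 (Sum.elim x v) y)) → (∀ x v, v ∈ B x ↔ φB.Realize (Sum.elim (Sum.elim x v) y)) → (∀ x v, v ∈ C x ↔ φC.Realize (Sum.elim (Sum.elim x v) y)) → (∀ i ∈ I, ∀ j ∈ I, ∀ k ∈ I, (i = j ∨ j = k ∨ k = i) → ∀ s ∈ A k, ∀ s' ∈ A i, ∀ t ∈ B i, ∀ t' ∈ B j, ∀ u ∈ C j, ∀ u' ∈ C k, (s' - s) + (t' - t) + (u' - u) = 0 → i = j ∧ j = k ∧ s = s' ∧ t = t' ∧ u = u') → ∀ ε : ℝ, 0 < ε → ε ≤ 1 / ((m : ℝ) + 1) → ∑ x ∈ I, (((A x).card * (B x).card * (C x).card : ℕ) : ℝ) ^ ((2 + ε) / 3) ≤ K * (Fintype.card F : ℝ) ^ (m : ℝ)) := by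
  intro e m k φI φA φB φC
  obtain ⟨C₀, q₁, hbd⟩ := hS e m k φI φA φB φC
  refine ⟨(C₀ : ℝ) + (2 + C₀) / 3, q₁, ?_⟩
  intro F _ _ _ hchar y I A B C hI hA hB hC hpair ε hε hεle
  -- `ε ≤ 1` and `mε ≤ 1` from `ε ≤ 1/(m+1)`
  have hm0 : (0 : ℝ) ≤ m := Nat.cast_nonneg m
  have hε1 : ε ≤ 1 := by
    refine hεle.trans ?_
    rw [div_le_one (by linarith)]; linarith
  have hmε : (m : ℝ) * ε ≤ 1 := by
    calc (m : ℝ) * ε ≤ m * (1 / ((m : ℝ) + 1)) := mul_le_mul_of_nonneg_left hεle hm0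
      _ = m / ((m : ℝ) + 1) := mul_one_div _ _
      _ ≤ 1 := by rw [div_le_one (by linarith)]; linarith
  -- the ambient group `F^m` has `|F|^m` elements and `|F| ≥ 1`
  have hq1 : (1 : ℝ) ≤ (Fintype.card F : ℝ) := by exact_mod_cast Fintype.card_pos
  have hH : (Fintype.card (Fin m → F) : ℝ) = (Fintype.card F : ℝ) ^ (m : ℝ) := by
    rw [Real.rpow_natCast, Fintype.card_fun, Fintype.card_fin]; push_cast; rfl
  -- the shadow bound for this family, read for the rotated family `(C, A, B)`
  have hshadow := hbd F hchar y I A B C hI hA hB hC hpair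
  have hshadow' : ∑ x ∈ I.filter (fun x => C₀ < (A x).card), ((C x).card : ℝ) * (B x).card
      ≤ C₀ * (Fintype.card F : ℝ) ^ ((m : ℝ) - 1) := by
    calc ∑ x ∈ I.filter (fun x => C₀ < (A x).card), ((C x).card : ℝ) * (B x).card
        = ∑ x ∈ I.filter (fun x => C₀ < (A x).card), ((B x).card : ℝ) * (C x).card :=
          sum_congr rfl fun x _ => mul_comm _ _
      _ ≤ C₀ * (Fintype.card F : ℝ) ^ ((m : ℝ) - 1) := hshadow
  -- the clause for the rotated family `(C, A, B)` and the mass bound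
  have hrot := MassBound.pairwiseClause_rotate (MassBound.pairwiseClause_rotate hpair)
  have hmassle :=
    MassBound.mass_le_of_shadowBound I C A B hrot C₀ hq1 m hH hshadow' hε hε1 hmε
  calc ∑ x ∈ I, (((A x).card * (B x).card * (C x).card : ℕ) : ℝ) ^ ((2 + ε) / 3)
      = ∑ x ∈ I, (((C x).card * (A x).card * (B x).card : ℕ) : ℝ) ^ ((2 + ε) / 3) :=
        sum_congr rfl fun x _ => by congr 2; ring
    _ ≤ ((C₀ : ℝ) + (2 + C₀) / 3) * (Fintype.card F : ℝ) ^ (m : ℝ) := hmassle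

end Summit.MatrixMultiplication.MatrixMultiplication.Theorems.HexagonClearanceR
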